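import Mathlib

/-!
# Negative moments from polynomial small-ball bounds (dyadic layer cake)

Stub `stub_negMomentOfSmallBalls` of crux `stmt-QuantumFields-9151`
(`Summit.QuantumFields.QCD.Theses.PauliWegnerSea.PhaseQuenchedFlavourDecay`,
line `crossing-split-integrability`): the abstract layer-cake input of the integrability half of
the a-priori bound on phase-quenched moments of Wick minors.

If a non-negative random variable `F` on a probability space obeys the small-ball estimate
`μ {F ≤ ε F₀} ≤ C ε ^ c` for every `ε > 0`, then for every exponent `0 < s < c` the negative
moment `∫ F ^ (-s) dμ` is finite and at most `K * F₀ ^ (-s)`, where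
`K = 1 + 2 ^ s * C * (1 - 2 ^ s / 2 ^ c)⁻¹` depends on `(C, c, s)` only -- not on the probability
space, on `F`, or on the reference level `F₀ > 0`.

Proof: the pointwise dyadic bound (`ofReal_rpow_neg_le_dyadic_sum`)
`F ω ^ (-s) ≤ F₀ ^ (-s) * (1 + ∑_j (2 ^ s) ^ (j + 1) · 1{F ≤ (2 ^ j)⁻¹ F₀}(ω))`
(at points with `F ω = 0` the left side is Lean's junk value `0`), integrated term by term in
`ℝ≥0∞` and summed as the geometric series `∑_j (2 ^ s / 2 ^ c) ^ j`.
-/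

noncomputable section

namespace Summit.QuantumFields.QCD.Cruxes.PhaseQuenchedFlavourDecay.CrossingSplitIntegrability

open MeasureTheory

/-- **Pointwise dyadic layer-cake bound.** For `0 ≤ F ω`, `0 < F₀` and `0 < s`, in `ℝ≥0∞`:
`F ω ^ (-s) ≤ F₀ ^ (-s) * (1 + ∑' j, (2 ^ s) ^ (j + 1) * 1{F ≤ (2 ^ j)⁻¹ F₀}(ω))`.
If `F₀ ≤ F ω` the constant `1` suffices; if `0 < F ω < F₀` the single term `j` with
`2 ^ j ≤ F₀ / F ω < 2 ^ (j + 1)` suffices; if `F ω = 0` the left side is the junk value `0`. -/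
theorem ofReal_rpow_neg_le_dyadic_sum {Ω : Type*} (F : Ω → ℝ) {F₀ s : ℝ} (hF₀ : 0 < F₀)
    (hs : 0 < s) (ω : Ω) (hω : 0 ≤ F ω) :
    ENNReal.ofReal (F ω ^ (-s)) ≤ ENNReal.ofReal (F₀ ^ (-s)) *
      (1 + ∑' j : ℕ, ENNReal.ofReal (((2 : ℝ) ^ s) ^ (j + 1)) *
        Set.indicator {ω' | F ω' ≤ ((2 : ℝ) ^ j)⁻¹ * F₀} 1 ω) := by
  rcases hω.eq_or_lt with hzero | hpos
  · -- `F ω = 0`: the junk value `0 ^ (-s) = 0`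
    rw [← hzero, Real.zero_rpow (neg_ne_zero.mpr hs.ne'), ENNReal.ofReal_zero]
    exact zero_le
  rcases le_or_gt F₀ (F ω) with hle | hlt
  · -- `F₀ ≤ F ω`: antitonicity of `x ↦ x ^ (-s)` on `(0, ∞)`
    calc ENNReal.ofReal (F ω ^ (-s))
        ≤ ENNReal.ofReal (F₀ ^ (-s)) * 1 := by
          rw [mul_one]
          exact ENNReal.ofReal_le_ofReal
            (Real.rpow_le_rpow_of_nonpos hF₀ hle (neg_nonpos.mpr hs.le))
      _ ≤ _ := mul_le_mul_right le_self_add _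
  · -- `0 < F ω < F₀`: locate the dyadic shell `2 ^ n ≤ F₀ / F ω < 2 ^ (n + 1)`
    have hx1 : 1 ≤ F₀ / F ω := by
      rw [le_div_iff₀ hpos, one_mul]
      exact hlt.le
    obtain ⟨n, hn, hn'⟩ := exists_nat_pow_near hx1 one_lt_two
    have hmem : ω ∈ {ω' | F ω' ≤ ((2 : ℝ) ^ n)⁻¹ * F₀} := by
      show F ω ≤ ((2 : ℝ) ^ n)⁻¹ * F₀
      rw [le_div_iff₀ hpos] at hn
      rw [inv_mul_eq_div, le_div_iff₀ (pow_pos two_pos n)]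
      exact (mul_comm _ _).trans_le hn
    have hpow : F ω ^ (-s) = F₀ ^ (-s) * (F₀ / F ω) ^ s := by
      rw [Real.div_rpow hF₀.le hpos.le, Real.rpow_neg hF₀.le, Real.rpow_neg hpos.le,
        mul_div_assoc', inv_mul_cancel₀ (Real.rpow_pos_of_pos hF₀ s).ne', one_div]
    have hshell : (F₀ / F ω) ^ s ≤ ((2 : ℝ) ^ s) ^ (n + 1) := by
      rw [Real.rpow_pow_comm zero_le_two s (n + 1)]
      exact Real.rpow_le_rpow (zero_le_one.trans hx1) hn'.le hs.le
    calc ENNReal.ofReal (F ω ^ (-s))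
        = ENNReal.ofReal (F₀ ^ (-s)) * ENNReal.ofReal ((F₀ / F ω) ^ s) := by
          rw [hpow, ENNReal.ofReal_mul (Real.rpow_nonneg hF₀.le _)]
      _ ≤ ENNReal.ofReal (F₀ ^ (-s)) * (ENNReal.ofReal (((2 : ℝ) ^ s) ^ (n + 1)) *
            Set.indicator {ω' | F ω' ≤ ((2 : ℝ) ^ n)⁻¹ * F₀} 1 ω) := by
          rw [Set.indicator_of_mem hmem, Pi.one_apply, mul_one]
          exact mul_le_mul_right (ENNReal.ofReal_le_ofReal hshell) _
      _ ≤ _ :=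
          mul_le_mul_right ((ENNReal.le_tsum (f := fun j : ℕ =>
            ENNReal.ofReal (((2 : ℝ) ^ s) ^ (j + 1)) *
              Set.indicator {ω' | F ω' ≤ ((2 : ℝ) ^ j)⁻¹ * F₀} 1 ω) n).trans le_add_self) _

/-- **Negative moments from small balls** (registered stub `stub_negMomentOfSmallBalls`).
A polynomial small-ball estimate `μ {F ≤ ε F₀} ≤ C ε ^ c` (all `ε > 0`) for a non-negative
random variable `F` on a probability space gives, for every `0 < s < c`, integrability of
`F ^ (-s)` together with `∫ F ^ (-s) dμ ≤ K * F₀ ^ (-s)`, where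
`K = 1 + 2 ^ s * C * (1 - 2 ^ s * (2 ^ c)⁻¹)⁻¹` depends on `(C, c, s)` only. -/
theorem stub_negMomentOfSmallBalls :
    ∀ (C c s : ℝ), 0 ≤ C → 0 < s → s < c → ∃ K : ℝ, 0 < K ∧
      ∀ (Ω : Type) [MeasurableSpace Ω] (μ : MeasureTheory.Measure Ω)
        [MeasureTheory.IsProbabilityMeasure μ]
        (F : Ω → ℝ) (F₀ : ℝ), Measurable F → (∀ ω, 0 ≤ F ω) → 0 < F₀ →
        (∀ ε : ℝ, 0 < ε → (μ {ω | F ω ≤ ε * F₀}).toReal ≤ C * ε ^ c) →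
          MeasureTheory.Integrable (fun ω => F ω ^ (-s)) μ ∧
            ∫ ω, F ω ^ (-s) ∂μ ≤ K * F₀ ^ (-s) := by
  intro C c s hC hs hsc
  -- dyadic constants: `2 ^ s`, `(2 ^ c)⁻¹`, and the ratio `2 ^ s * (2 ^ c)⁻¹ = 2 ^ (s - c) < 1`
  have hq : (0 : ℝ) < 2 ^ s := Real.rpow_pos_of_pos two_pos s
  have hpc : (0 : ℝ) < 2 ^ c := Real.rpow_pos_of_pos two_pos c
  have hr0 : (0 : ℝ) ≤ 2 ^ s * ((2 : ℝ) ^ c)⁻¹ := mul_nonneg hq.le (inv_pos.mpr hpc).le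
  have hqp : (2 : ℝ) ^ s * ((2 : ℝ) ^ c)⁻¹ < 1 := by
    rw [← div_eq_mul_inv, div_lt_one hpc]
    exact Real.rpow_lt_rpow_of_exponent_lt one_lt_two hsc
  have h1qp : (0 : ℝ) < 1 - 2 ^ s * ((2 : ℝ) ^ c)⁻¹ := sub_pos.mpr hqp
  have hK0 : (0 : ℝ) ≤ 2 ^ s * C * (1 - 2 ^ s * ((2 : ℝ) ^ c)⁻¹)⁻¹ :=
    mul_nonneg (mul_nonneg hq.le hC) (inv_pos.mpr h1qp).le
  obtain ⟨K, hK_def⟩ : ∃ K : ℝ, K = 1 + 2 ^ s * C * (1 - 2 ^ s * ((2 : ℝ) ^ c)⁻¹)⁻¹ := ⟨_, rfl⟩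
  have hKpos : 0 < K := by
    rw [hK_def]
    exact add_pos_of_pos_of_nonneg one_pos hK0
  refine ⟨K, hKpos, ?_⟩
  intro Ω _ μ _ F F₀ hF hF0 hF₀ hsmall
  have hmeas : Measurable fun ω => F ω ^ (-s) := hF.pow_const _
  have hnn : ∀ ω, 0 ≤ F ω ^ (-s) := fun ω => Real.rpow_nonneg (hF0 ω) _
  -- the dyadic sublevel sets `{F ≤ (2 ^ j)⁻¹ F₀}` and their measures
  have hAm : ∀ j : ℕ, MeasurableSet {ω | F ω ≤ ((2 : ℝ) ^ j)⁻¹ * F₀} := fun j =>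
    measurableSet_le hF measurable_const
  have hμA : ∀ j : ℕ, μ {ω | F ω ≤ ((2 : ℝ) ^ j)⁻¹ * F₀} ≤
      ENNReal.ofReal (C * (((2 : ℝ) ^ c)⁻¹) ^ j) := by
    intro j
    have hεc : (((2 : ℝ) ^ j)⁻¹) ^ c = (((2 : ℝ) ^ c)⁻¹) ^ j := by
      rw [Real.inv_rpow (pow_nonneg zero_le_two j), ← Real.rpow_pow_comm zero_le_two, inv_pow]
    have h := hsmall (((2 : ℝ) ^ j)⁻¹) (by positivity)
    rw [hεc] at h
    exact (ENNReal.le_ofReal_iff_toReal_le (measure_ne_top μ _) (by positivity)).2 h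
  -- term-by-term integration of the dyadic sum
  have hAE : ∀ j : ℕ, AEMeasurable (fun ω => ENNReal.ofReal (((2 : ℝ) ^ s) ^ (j + 1)) *
      Set.indicator {ω' | F ω' ≤ ((2 : ℝ) ^ j)⁻¹ * F₀} 1 ω) μ := fun j =>
    ((measurable_one.indicator (hAm j)).const_mul _).aemeasurable
  have hsum : ∫⁻ ω, (∑' j : ℕ, ENNReal.ofReal (((2 : ℝ) ^ s) ^ (j + 1)) *
      Set.indicator {ω' | F ω' ≤ ((2 : ℝ) ^ j)⁻¹ * F₀} 1 ω) ∂μ =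
        ∑' j : ℕ, ENNReal.ofReal (((2 : ℝ) ^ s) ^ (j + 1)) *
          μ {ω | F ω ≤ ((2 : ℝ) ^ j)⁻¹ * F₀} := by
    rw [lintegral_tsum hAE]
    exact tsum_congr fun j => by
      rw [lintegral_const_mul _ (measurable_one.indicator (hAm j)), lintegral_indicator_one (hAm j)]
  -- the geometric series `∑_j (2 ^ s)^(j+1) * C * ((2 ^ c)⁻¹) ^ j = 2 ^ s * C * ∑_j (2 ^ s / 2 ^ c) ^ j`
  have hterm : ∀ j : ℕ, ENNReal.ofReal (((2 : ℝ) ^ s) ^ (j + 1)) *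
      ENNReal.ofReal (C * (((2 : ℝ) ^ c)⁻¹) ^ j) = ENNReal.ofReal (2 ^ s * C) *
        ENNReal.ofReal (2 ^ s * ((2 : ℝ) ^ c)⁻¹) ^ j := by
    intro j
    rw [← ENNReal.ofReal_pow hr0, ← ENNReal.ofReal_mul (mul_nonneg hq.le hC),
      ← ENNReal.ofReal_mul (pow_nonneg hq.le (j + 1))]
    congr 1
    ring
  have hK : 1 + ENNReal.ofReal (2 ^ s * C) * (1 - ENNReal.ofReal (2 ^ s * ((2 : ℝ) ^ c)⁻¹))⁻¹ =
      ENNReal.ofReal K := by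
    rw [hK_def, ENNReal.ofReal_add zero_le_one hK0, ENNReal.ofReal_one,
      ENNReal.ofReal_mul (mul_nonneg hq.le hC), ENNReal.ofReal_inv_of_pos h1qp,
      ENNReal.ofReal_sub _ hr0, ENNReal.ofReal_one]
  -- the `ℝ≥0∞`-valued moment bound
  have hlint : ∫⁻ ω, ENNReal.ofReal (F ω ^ (-s)) ∂μ ≤ ENNReal.ofReal (K * F₀ ^ (-s)) := by
    calc ∫⁻ ω, ENNReal.ofReal (F ω ^ (-s)) ∂μ
        ≤ ∫⁻ ω, ENNReal.ofReal (F₀ ^ (-s)) *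
            (1 + ∑' j : ℕ, ENNReal.ofReal (((2 : ℝ) ^ s) ^ (j + 1)) *
              Set.indicator {ω' | F ω' ≤ ((2 : ℝ) ^ j)⁻¹ * F₀} 1 ω) ∂μ :=
          lintegral_mono fun ω => ofReal_rpow_neg_le_dyadic_sum F hF₀ hs ω (hF0 ω)
      _ = ENNReal.ofReal (F₀ ^ (-s)) * (1 + ∑' j : ℕ, ENNReal.ofReal (((2 : ℝ) ^ s) ^ (j + 1)) *
            μ {ω | F ω ≤ ((2 : ℝ) ^ j)⁻¹ * F₀}) := by
          rw [lintegral_const_mul' _ _ ENNReal.ofReal_ne_top, lintegral_add_left measurable_const,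
            lintegral_const, measure_univ, mul_one, hsum]
      _ ≤ ENNReal.ofReal (F₀ ^ (-s)) * (1 + ∑' j : ℕ, ENNReal.ofReal (((2 : ℝ) ^ s) ^ (j + 1)) *
            ENNReal.ofReal (C * (((2 : ℝ) ^ c)⁻¹) ^ j)) :=
          mul_le_mul_right (add_le_add_right
            (ENNReal.tsum_le_tsum fun j => mul_le_mul_right (hμA j) _) _) _
      _ = ENNReal.ofReal (K * F₀ ^ (-s)) := by
          rw [tsum_congr hterm, ENNReal.tsum_mul_left, ENNReal.tsum_geometric, hK,
            ENNReal.ofReal_mul' (Real.rpow_nonneg hF₀.le _)]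
          exact mul_comm _ _
  have hne : ∫⁻ ω, ENNReal.ofReal (F ω ^ (-s)) ∂μ ≠ ⊤ :=
    ne_top_of_le_ne_top ENNReal.ofReal_ne_top hlint
  refine ⟨(lintegral_ofReal_ne_top_iff_integrable hmeas.aestronglyMeasurable
    (Filter.Eventually.of_forall hnn)).1 hne, ?_⟩
  rw [integral_eq_lintegral_of_nonneg_ae (Filter.Eventually.of_forall hnn)
    hmeas.aestronglyMeasurable]
  exact ENNReal.toReal_le_of_le_ofReal (mul_nonneg hKpos.le (Real.rpow_nonneg hF₀.le _)) hlint

end Summit.QuantumFields.QCD.Cruxes.PhaseQuenchedFlavourDecay.CrossingSplitIntegrability
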